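import Summits.ABC.IUTFork.Joshi.LogVolumesHullsPacket
import HarnessLib

/-!
# (9.10.3.1) as a SET FUNCTION on the tensor packet ⟺ `γ_i·d_i` constant — and, with Joshi's `Γ_p`, ⟺ the local degrees
# `[L_{mod,v_a} : ℚ_p]` agree across the capsule (the CROSS-PLACE summands of (9.4.10.1))

Proof-only rider (abc-iut cell, block E, rung LADDER-ABC:A2.E; seat abc-iut-E-t56 — [J-III] lane-B typer-side reader; offered to the
slot owner abc-iut-E-t23 on STATUS 2026-08-26T10:08Z, AUTHORS-FIRST window) over abc-iut-E-t23's `Joshi/LogVolumesHullsPacket.lean`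
(p432636) BY NAME. Source: K. Joshi, arXiv:2401.13508 **v4** (unrefereed; bib `Joshi2024ATS3`), §9.10.3 (9.10.3.1) p.124 l.8–11
(«it suffices to define Vol^Γ(V_1 ⊗_{ℤ_p} … ⊗_{ℤ_p} V_n) = Vol^{γ_1}(V_1) ··· Vol^{γ_n}(V_n)»), §9.10.5 (9.10.5.1) p.125 l.9–15
(`Γ_p = {1/[L′_{w_i} : L_{mod,v}]}`, «coincides with the choice of weights in [Mochizuki, 2021c, Remark 3.1.1]»), §9.10.6 p.125 l.20–26
(«for any measurable set S ⊂ ^{S_{j+1}}𝓘^{ℚ_p}_{Mochizuki,p} one can talk of its volume Vol(S)»), and §9.4.10 (9.4.10.1) p.106 l.61–86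
(the summands `⊗_{a ∈ S_{j+1}} L′_{w_a}` over COLLECTIONS `(w_a)_a` of places over one `p`; abc-iut-E-t20 `packetQDecomposition` p429647).

WHAT p432636 (C) proved: in `V = ⊗_{ℚ_p} k_i` the SETS `(⊗(1,…,p_i,…,1))·(R_I)^∼` coincide for all positions `i` while the tuple
recipe (9.10.3.1) gives them log-volumes differing by `(γ_j d_j − γ_i d_i)·log p`. HERE this is packaged as the statement §M can cite:
* `weightDegree_eq_of_setFunction` — if (9.10.3.1) is the restriction of ANY function of subsets `VolP : Set V → ℝ` to the
  pure-tensor translates `(⊗h_i)·(R_I)^∼` (no Haar hypothesis whatsoever), then `γ_i·d_i = γ_j·d_j` for all factors;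
* `localDegree_eq_of_setFunction` — with Joshi's `Γ_p` read through abc-iut-E-t23's tower-law shape (`gammaP_mul_degree`:
  `γ_i·d_i = [L_{mod,v_i} : ℚ_p]`), a set function forces the local degrees `[L_{mod,v_a} : ℚ_p]` of the capsule members to AGREE;
  `not_setFunction_of_localDegree_ne` — on a cross-place summand with two members of different local degree over `ℚ_p`, NO set
  function on `V` restricts to (9.10.3.1)+`Γ_p`;
* `setFunction_of_weightDegree_const` — conversely (non-vacuity, from p432636 (B)), if `γ_i·d_i ≡ c` then
  `VolP := exp(c · μ^log_{[IUTchIV] Prop 1.4})` (campaign-S `packetLogVolume`) does restrict to (9.10.3.1).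
LOCATED SENTENCE (numbers, no verdict): «(9.10.3.1) with the weights Γ_p is a function of the subset V_1 ⊗ ⋯ ⊗ V_n ⊂ ⊗_a L′_{w_a} — as
§9.10.6 presupposes — iff [L_{mod,v_a} : ℚ_p] is constant along the capsule; at a fixed place (all w_a = w, abc-iut-E-t23's L2) it is,
on the cross-place summands of (9.4.10.1) it is iff the places of L_mod over p involved have one local degree; print's ‹coincides with
[Mochizuki 2021c, Rmk 3.1.1]› (p.125 l.13–15) is the attach point.» Classical bookkeeping; 0 definitions; nothing of Joshi's construction and
no clause of [IUTchIII] Cor. 3.12 is asserted; no side taken on any author; typed ≠ proved.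
-/

noncomputable section

namespace Summit.ABC.IUTFork.Joshi.LogVol

open MeasureTheory Metric Literature.IUT.LogVolume
open scoped Pointwise

variable {p : ℕ} [hp : Fact p.Prime]
variable {I : Type} [Fintype I] [DecidableEq I]
variable {k : I → Type} [∀ i, NontriviallyNormedField (k i)] [instA : ∀ i, NormedAlgebra ℚ_[p] (k i)]
  [∀ i, IsUltrametricDist (k i)] [∀ i, ProperSpace (k i)] [∀ i, MeasurableSpace (k i)] [∀ i, BorelSpace (k i)]

/-- **(9.10.3.1) «is a set function on the pure-tensor translates»**: SOME function of subsets of `V = ⊗_{ℚ_p} k_i` restricts to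
Joshi's tuple recipe on the sets `(⊗_i h_i)·(R_I)^∼`, `h_i ≠ 0` (what §9.10.6 «for any measurable set S … Vol(S)» presupposes).
A `Prop` about (factor data, weights); no Haar measure is assumed; READING PREDICATE recording §9.10.6's presupposition,
never asserted. [claim: Joshi2024ATS3, status: disputed] -/
@[claim "Joshi2024ATS3" "disputed"]
def IsSetFunction (F : FactorData k) (Γ : Weights I) : Prop :=
  ∃ VolP : Set (PacketAlgebra p k) → ℝ, ∀ h : Π i, k i, (∀ i, h i ≠ 0) →
    weightedVol F.volumeData Γ (fun i => (F.volumeData i).ball 0 (h i)) =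
      VolP (purePacket p k h • (normalizedPacket p k : Set (PacketAlgebra p k)))

omit [Fintype I] [∀ i, IsUltrametricDist (k i)] [∀ i, ProperSpace (k i)] [∀ i, MeasurableSpace (k i)]
  [∀ i, BorelSpace (k i)] in
/-- The tuple `(1, …, p, …, 1)` (`p` in slot `i`) has nonzero entries. [folklore] -/
theorem update_one_natCast_ne_zero (i i' : I) : Function.update (1 : Π i', k i') i (p : k i) i' ≠ 0 := by
  rcases eq_or_ne i' i with rfl | hne
  · rw [Function.update_self]; exact prime_ne_zero p (k _)
  · rw [Function.update_of_ne hne]; exact one_ne_zero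

/-- **SET FUNCTION ⇒ `γ_i·d_i` CONSTANT** (numbers, no verdict): if (9.10.3.1) is the restriction of any function of subsets of the
tensor packet, then `γ_i·d_i = γ_j·d_j` for all factors — the two ball-tuples with `p` in slot `i` resp. `j` define the SAME subset
(p432636 `smul_normalizedPacket_update_eq`) but have tuple log-volumes differing by `(γ_j d_j − γ_i d_i)·log p` (p432636
`log_weightedVol_update_sub`). [claim: Joshi2024ATS3, status: disputed] -/
theorem weightDegree_eq_of_setFunction (F : FactorData k) (Γ : Weights I) (h : IsSetFunction (p := p) F Γ) (i j : I) :
    Γ.γ i * (F.d i) = Γ.γ j * (F.d j) := by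
  obtain ⟨VolP, hV⟩ := h
  have hi := hV _ (update_one_natCast_ne_zero (p := p) i)
  have hj := hV _ (update_one_natCast_ne_zero (p := p) j)
  rw [smul_normalizedPacket_update_eq (p := p) (k := k) i j] at hi
  have heq : Real.log (weightedVol F.volumeData Γ fun i' =>
        (F.volumeData i').ball 0 (Function.update (1 : Π i', k i') i (p : k i) i')) -
      Real.log (weightedVol F.volumeData Γ fun i' =>
        (F.volumeData i').ball 0 (Function.update (1 : Π i', k i') j (p : k j) i')) = 0 := by
    rw [hi, hj, sub_self]
  rw [log_weightedVol_update_sub (p := p) F Γ i j] at heq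
  have hlog : Real.log (p : ℝ) ≠ 0 := (Real.log_pos (by exact_mod_cast hp.out.one_lt)).ne'
  have := (mul_eq_zero.1 heq).resolve_right hlog
  linarith

/-- **With Joshi's `Γ_p` (9.10.5.1): SET FUNCTION ⇒ THE LOCAL DEGREES AGREE.** If the weights and degrees stand in abc-iut-E-t23's
tower-law relation `γ_i·d_i = [L_{mod,v_i} : ℚ_p]` (`gammaP_mul_degree`: `γ_i = 1/[k_i : L_{mod,v_i}]`, `d_i = [k_i : L_{mod,v_i}]·
[L_{mod,v_i} : ℚ_p]`), then a set function forces `[L_{mod,v_i} : ℚ_p] = [L_{mod,v_j} : ℚ_p]` for all capsule members. [claim: Joshi2024ATS3, status: disputed] -/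
theorem localDegree_eq_of_setFunction (F : FactorData k) (Γ : Weights I) (dmod : I → ℕ)
    (htower : ∀ i, Γ.γ i * (F.d i) = dmod i) (h : IsSetFunction (p := p) F Γ) (i j : I) : dmod i = dmod j := by
  have := weightDegree_eq_of_setFunction F Γ h i j
  rw [htower i, htower j] at this
  exact_mod_cast this

/-- The same with the weights GIVEN as Joshi's `Γ_p` over a place map `v : I → W` and relative degrees `deg w = [k : L_{mod,w}]`
(`gammaP`), the degrees factoring by the tower law `d_i = deg(v_i)·[L_{mod,v_i} : ℚ_p]`. [claim: Joshi2024ATS3, status: disputed] -/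
theorem localDegree_eq_of_setFunction_gammaP (F : FactorData k) (Γ : Weights I) {W : Type} (v : I → W) (deg : W → ℕ+)
    (dmod : I → ℕ) (hγ : ∀ i, Γ.γ i = gammaP deg (v i)) (hd : ∀ i, F.d i = (deg (v i) : ℕ) * dmod i)
    (h : IsSetFunction (p := p) F Γ) (i j : I) : dmod i = dmod j :=
  localDegree_eq_of_setFunction F Γ dmod (fun i => by rw [hγ i]; exact gammaP_mul_degree deg (v i) (hd i)) h i j

/-- **CROSS-PLACE summands: NO set function.** On a summand `⊗_a L′_{w_a}` of (9.4.10.1) two of whose capsule members lie over places of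
`L_mod` of DIFFERENT local degree over `ℚ_p`, Joshi's (9.10.3.1) with `Γ_p` is NOT the restriction of any function of subsets of the
tensor packet — §9.10.6's «for any measurable set S … Vol(S)» and (9.10.3.1)+(9.10.5.1) pull apart there. (Numbers, no verdict on
which reading print intends.) [claim: Joshi2024ATS3, status: disputed] -/
theorem not_setFunction_of_localDegree_ne (F : FactorData k) (Γ : Weights I) (dmod : I → ℕ)
    (htower : ∀ i, Γ.γ i * (F.d i) = dmod i) {i j : I} (hne : dmod i ≠ dmod j) : ¬ IsSetFunction (p := p) F Γ :=
  fun h => hne (localDegree_eq_of_setFunction F Γ dmod htower h i j)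

section Converse

variable {J : Type} [Fintype J] (L : J → Type) [∀ j, NontriviallyNormedField (L j)] [∀ j, NormedAlgebra ℚ_[p] (L j)]
  [∀ j, IsUltrametricDist (L j)] [∀ j, ProperSpace (L j)] [∀ j, MeasurableSpace (L j)] [∀ j, BorelSpace (L j)]

omit [DecidableEq I] in
/-- The weighted volume of a ball-tuple with nonzero radii is POSITIVE (so its `log` determines it). [folklore] -/
theorem weightedVol_balls_pos (F : FactorData k) (Γ : Weights I) (h : Π i, k i) (hh : ∀ i, h i ≠ 0) :
    0 < weightedVol F.volumeData Γ (fun i => (F.volumeData i).ball 0 (h i)) := by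
  rw [show (fun i => (F.volumeData i).ball 0 (h i)) = fun i => (F.volumeData i).ball ((0 : Π i, k i) i) (h i) from rfl,
    weightedVol_ball F.volumeData Γ 0 h hh]
  exact Finset.prod_pos fun i _ => Real.rpow_pos_of_pos ((F.volumeData i).abs.pos (hh i)) _

/-- **Converse (non-vacuity): `γ_i·d_i ≡ c` ⇒ (9.10.3.1) IS a set function**, namely the restriction of `exp(c·μ^log)` with `μ^log` =
Mochizuki's [IUTchIV] Prop. 1.4 (i) degree-normalised packet log-volume (campaign-S `packetLogVolume`; p432636 (B)). So at a fixed
place — all factors `≅ L′_w`, `c = [L_{mod,v} : ℚ_p]` — Joshi's recipe and a Haar-type set function agree. [claim: Joshi2024ATS3, status: disputed] -/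
theorem setFunction_of_weightDegree_const [Nonempty I] [Nonempty J] (ψ : PacketAlgebra p k ≃ₐ[ℚ_[p]] (Π j, L j))
    (F : FactorData k) (Γ : Weights I) (c : ℝ) (hc : ∀ i, Γ.γ i * (F.d i) = c) : IsSetFunction (p := p) F Γ := by
  refine ⟨fun S => Real.exp (c * packetLogVolume p k L ψ S), fun h hh => ?_⟩
  have hlog := log_weightedVol_eq_mul_packetLogVolume (p := p) L ψ F Γ c hc h hh
  have h1 : ppow p k 0 * purePacket p k h = purePacket p k h := by
    rw [ppow, zpow_zero, map_one, one_mul]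
  rw [h1] at hlog
  show _ = Real.exp (c * packetLogVolume p k L ψ (purePacket p k h • (normalizedPacket p k : Set (PacketAlgebra p k))))
  rw [← hlog, Real.exp_log (weightedVol_balls_pos F Γ h hh)]

/-- **(9.10.3.1) is a set function on `V` IFF `γ_i·d_i` is constant** (given at least one factor and one field in the decomposition
`ψ`). [claim: Joshi2024ATS3, status: disputed] -/
theorem isSetFunction_iff_weightDegree_const [Nonempty I] [Nonempty J] (ψ : PacketAlgebra p k ≃ₐ[ℚ_[p]] (Π j, L j))
    (F : FactorData k) (Γ : Weights I) : IsSetFunction (p := p) F Γ ↔ ∃ c : ℝ, ∀ i, Γ.γ i * (F.d i) = c := by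
  constructor
  · intro h
    obtain ⟨i₀⟩ := ‹Nonempty I›
    exact ⟨Γ.γ i₀ * (F.d i₀), fun i => weightDegree_eq_of_setFunction F Γ h i i₀⟩
  · rintro ⟨c, hc⟩
    exact setFunction_of_weightDegree_const L ψ F Γ c hc

end Converse

end Summit.ABC.IUTFork.Joshi.LogVol

end
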